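import Mathlib
import Literature.Probability.LatticeModels.GKSInequalities
import Summits.CriticalPhenomena.Ising3DConformalLimit.Theorems.PrecisionLaplacianInverseMFerromagnetLaw2Four
import Summits.CriticalPhenomena.Ising3DConformalLimit.Theorems.PrecisionLaplacianInverseMFerromagnetEntryNonposOfPcov
import HarnessLib

/-!
# Crux `PrecisionLaplacian.InverseMFerromagnet` (stmt-CriticalPhenomena-4798), line `Sketch` —
# `helper_law2_six_free`: `Law₂` on six sites with two free sites, by transport to four sites

THEOREM-ONLY file (no definitions).  `Law₂` (the one open leaf of the line) says: for a
zero-field pair ferromagnet and 3-sets `A, B`, `v_Aᵀ Σ⁻¹ v_B ≤ ⟨σ_Aσ_B⟩` with `Σ_pq = ⟨σ_pσ_q⟩`,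
`v_A(w) = ⟨σ_Aσ_w⟩`.  It is landed on `Fin 4` for all couplings (`helper_law2_four`).  Here we
prove it on `Fin 6` when two distinct sites `x, y` lie in no bond and `A, B` avoid `x, y`.

Proof (pure transport).  Let `S = univ ∖ {x, y}` (`|S| = 4`) and `e : Fin 4 ↪ Fin 6` the increasing
enumeration of `S`.  Every bond and `A, B` are images `C i = e(C' i)`, `A = e(A')`, `B = e(B')`;
write `Σ'`, `v'` for the pair matrix and vectors of the four-site system `(K, C')`.
* The weight factorises, `w(ω) = w'(ω ∘ e)`, and `ω ↦ ω ∘ e` has fibres of constant size, so every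
  observable of `ω ∘ e` has the same expectation in the six-site system `(K, C)` and in the
  four-site system `(K, C')` (`l6f_gksExpect_map`); in particular `Σ_{e i, e j} = Σ'_{ij}`,
  `v_A(e j) = v'_{A'}(j)`, `⟨σ_Aσ_B⟩ = ⟨σ_{A'}σ_{B'}⟩'`.
* The sites `x, y` are free: flipping `σ_x` preserves the weight, so `⟨σ_x F⟩ = 0` for every
  flip-invariant `F` (`l6f_free`); hence `Σ_{x, e j} = 0` and `v_B(x) = 0` (same for `y`).
* Linear algebra (`l6f_dot_inv`): the extension by zero `u` of `Σ'⁻¹ v'_{B'}` satisfies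
  `Σ u = v_B` (rows `e i` by `Σ'Σ'⁻¹ = 1`, rows `x, y` because both sides vanish), so
  `Σ⁻¹ v_B = u` and `v_Aᵀ Σ⁻¹ v_B = v'_{A'}ᵀ Σ'⁻¹ v'_{B'}`.
Then `helper_law2_four` for `(K, C', A', B')` is exactly the claim.
-/

namespace Summit.CriticalPhenomena.Ising3DConformalLimit.Cruxes.InverseMFerromagnet.PartialCovarianceLadder

open Literature.Probability.LatticeModels Finset Matrix

/-! ## Pushing a spin system forward along an injection of the sites -/

/-- `σ_j(ω ∘ e) = σ_{e j}(ω)`. [folklore] -/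
theorem l6f_spinAt_comp {V W : Type*} (e : V ↪ W) (j : V) (ω : SpinConfig W) :
    spinAt j (ω ∘ e) = spinAt (e j) ω := rfl

/-- `σ_{e(t)}(ω) = σ_t(ω ∘ e)`. [folklore] -/
theorem l6f_spinProduct_map {V W : Type*} (e : V ↪ W) (t : Finset V) (ω : SpinConfig W) :
    spinProduct (t.map e) ω = spinProduct t (ω ∘ e) := by
  rw [spinProduct, spinProduct, Finset.prod_map]
  rfl

/-- `σ_t(ω ∘ e) = σ_{e(t)}(ω)` (the normalising direction). [folklore] -/
theorem l6f_spinProduct_comp {V W : Type*} (e : V ↪ W) (t : Finset V) (ω : SpinConfig W) :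
    spinProduct t (ω ∘ e) = spinProduct (t.map e) ω :=
  (l6f_spinProduct_map e t ω).symm

/-- The Boltzmann weight of the pushed-forward system `(K, e(C'))` at `ω` is the weight of
`(K, C')` at the restriction `ω ∘ e`. [folklore] -/
theorem l6f_gksWeight_map {V W ι : Type*} (s : Finset ι) (e : V ↪ W) (K : ι → ℝ)
    (C' : ι → Finset V) (ω : SpinConfig W) :
    gksWeight s K (fun i => (C' i).map e) ω = gksWeight s K C' (ω ∘ e) := by
  simp only [gksWeight, gksHamiltonian, l6f_spinProduct_map]

/-- Unnormalised sums of observables of the restriction `ω ∘ e` under `(K, e(C'))` are a fixed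
positive multiple (the number of extensions) of the sums under `(K, C')`. [folklore] -/
theorem l6f_gksSum_map {V W ι : Type*} [Fintype V] [DecidableEq V] [Fintype W] [DecidableEq W]
    (s : Finset ι) (e : V ↪ W) (K : ι → ℝ) (C' : ι → Finset V) :
    ∃ c : ℕ, 0 < c ∧ ∀ G : SpinConfig V → ℝ,
      gksSum s K (fun i => (C' i).map e) (fun ω => G (ω ∘ e)) = c • gksSum s K C' G := by
  obtain ⟨c, hc, h⟩ := exists_sum_comp_eq_smul (α := W) (α₁ := V) ℤˣ e e.injective
  refine ⟨c, hc, fun G => ?_⟩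
  simp only [gksSum, l6f_gksWeight_map]
  exact h (fun τ => G τ * gksWeight s K C' τ)

/-- **Transport of expectations along an injection of the sites**: observables of `ω ∘ e` have
the same expectation under `(K, e(C'))` on `W` and under `(K, C')` on `V` (the sites off the
range of `e` are free and integrate out). [folklore] -/
theorem l6f_gksExpect_map {V W ι : Type*} [Fintype V] [DecidableEq V] [Fintype W] [DecidableEq W]
    (s : Finset ι) (e : V ↪ W) (K : ι → ℝ) (C' : ι → Finset V) (G : SpinConfig V → ℝ) :
    gksExpect s K (fun i => (C' i).map e) (fun ω => G (ω ∘ e)) = gksExpect s K C' G := by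
  obtain ⟨c, hc, h⟩ := l6f_gksSum_map s e K C'
  have hc' : (c : ℝ) ≠ 0 := by exact_mod_cast hc.ne'
  have h1 := h (fun _ => 1)
  rw [gksExpect, gksExpect, h G, h1, nsmul_eq_mul, nsmul_eq_mul, mul_div_mul_left _ _ hc']

/-! ## Free sites -/

/-- Flipping the spin at `z` negates `σ_z`. [folklore] -/
theorem l6f_spinAt_flip_same {W : Type*} [DecidableEq W] (z : W) (ω : SpinConfig W) :
    spinAt z (ω * Pi.mulSingle z (-1)) = -spinAt z ω := by
  simp [spinAt, Pi.mulSingle_eq_same, Units.val_neg]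

/-- Flipping the spin at `z` fixes `σ_p`, `p ≠ z`. [folklore] -/
theorem l6f_spinAt_flip_ne {W : Type*} [DecidableEq W] {z p : W} (h : p ≠ z) (ω : SpinConfig W) :
    spinAt p (ω * Pi.mulSingle z (-1)) = spinAt p ω := by
  simp [spinAt, Pi.mulSingle_eq_of_ne h]

/-- Flipping the spin at `z ∉ t` fixes `σ_t`. [folklore] -/
theorem l6f_spinProduct_flip {W : Type*} [DecidableEq W] {t : Finset W} {z : W} (hz : z ∉ t)
    (ω : SpinConfig W) : spinProduct t (ω * Pi.mulSingle z (-1)) = spinProduct t ω :=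
  Finset.prod_congr rfl fun _ hp => l6f_spinAt_flip_ne (ne_of_mem_of_not_mem hp hz) ω

/-- **Free sites.** If `z` lies in no bond then `⟨σ_z F⟩ = 0` for every observable `F` invariant
under the flip of `σ_z` (the flip preserves the weight and negates the integrand). [folklore] -/
theorem l6f_free {W ι : Type*} [Fintype W] [DecidableEq W] (s : Finset ι) (K : ι → ℝ)
    (C : ι → Finset W) (z : W) (hz : ∀ i ∈ s, z ∉ C i) (F : SpinConfig W → ℝ)
    (hF : ∀ ω, F (ω * Pi.mulSingle z (-1)) = F ω) :
    gksExpect s K C (fun ω => spinAt z ω * F ω) = 0 := by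
  have hw : ∀ ω, gksWeight s K C (ω * Pi.mulSingle z (-1)) = gksWeight s K C ω := fun ω => by
    simp only [gksWeight, gksHamiltonian]
    congr 1
    exact Finset.sum_congr rfl fun i hi => by rw [l6f_spinProduct_flip (hz i hi)]
  have hsum : ∑ ω : SpinConfig W, spinAt z ω * F ω * gksWeight s K C ω = 0 := by
    have h := Fintype.sum_equiv (Equiv.mulRight (Pi.mulSingle z (-1) : SpinConfig W))
      (fun ω => spinAt z ω * F ω * gksWeight s K C ω)
      (fun ω => -(spinAt z ω * F ω * gksWeight s K C ω)) (fun ω => by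
        simp only [Equiv.coe_mulRight, hF, hw, l6f_spinAt_flip_same]; ring)
    rw [Finset.sum_neg_distrib] at h
    linarith
  rw [gksExpect, gksSum, hsum, zero_div]

/-- Sites off the range of `e` lie in no pushed-forward set `e(t)`. [folklore] -/
theorem l6f_not_mem_map {V W : Type*} (e : V ↪ W) (t : Finset V) {p : W}
    (hp : p ∉ Set.range e) : p ∉ t.map e := fun h => by
  obtain ⟨j, -, rfl⟩ := Finset.mem_map.1 h
  exact hp ⟨j, rfl⟩

/-- `⟨σ_p σ_{e j}⟩ = 0` for `p` off the range of `e` (a free site of `(K, e(C'))`). [folklore] -/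
theorem l6f_pair_zero {V W ι : Type*} [Fintype V] [DecidableEq V] [Fintype W] [DecidableEq W]
    [Fintype ι] (e : V ↪ W) (K : ι → ℝ) (C' : ι → Finset V) {p : W} (hp : p ∉ Set.range e)
    (j : V) :
    gksExpect Finset.univ K (fun i => (C' i).map e) (fun ω => spinAt p ω * spinAt (e j) ω) = 0 :=
  l6f_free _ K _ p (fun i _ => l6f_not_mem_map e (C' i) hp) _
    (fun ω => l6f_spinAt_flip_ne (fun h => hp ⟨j, h⟩) ω)

/-- `⟨σ_{e(B')} σ_p⟩ = 0` for `p` off the range of `e`. [folklore] -/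
theorem l6f_vec_zero {V W ι : Type*} [Fintype V] [DecidableEq V] [Fintype W] [DecidableEq W]
    [Fintype ι] (e : V ↪ W) (K : ι → ℝ) (C' : ι → Finset V) (B' : Finset V) {p : W}
    (hp : p ∉ Set.range e) :
    gksExpect Finset.univ K (fun i => (C' i).map e)
      (fun ω => spinProduct (B'.map e) ω * spinAt p ω) = 0 := by
  have h : (fun ω : SpinConfig W => spinProduct (B'.map e) ω * spinAt p ω)
      = fun ω => spinAt p ω * spinProduct (B'.map e) ω := funext fun ω => mul_comm _ _
  rw [h]
  exact l6f_free _ K _ p (fun i _ => l6f_not_mem_map e (C' i) hp) _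
    (fun ω => l6f_spinProduct_flip (l6f_not_mem_map e B' hp) ω)

/-! ## The linear algebra of the block reduction -/

/-- **Block reduction of `aᵀ M⁻¹ b`.** If the invertible `M` restricted along a map of index
types `e` is the invertible `N`, the rows of `M` off the range of `e` vanish on the range, and
`b` vanishes off the range, then `M⁻¹ b` is the push-forward (extension by zero) of `N⁻¹ b'`,
whence `aᵀ M⁻¹ b = a'ᵀ N⁻¹ b'` as soon as `a, b` restrict to `a', b'` along `e`. [folklore] -/
theorem l6f_dot_inv {V W : Type*} [Fintype V] [DecidableEq V] [Fintype W] [DecidableEq W]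
    (e : V → W) (M : Matrix W W ℝ) (N : Matrix V V ℝ)
    (hM : IsUnit M.det) (hN : IsUnit N.det) (a b : W → ℝ) (a' b' : V → ℝ)
    (hsub : ∀ i j, M (e i) (e j) = N i j) (hoff : ∀ p, p ∉ Set.range e → ∀ j, M p (e j) = 0)
    (ha : ∀ j, a (e j) = a' j) (hb : ∀ j, b (e j) = b' j)
    (hb0 : ∀ p, p ∉ Set.range e → b p = 0) :
    dotProduct a (M⁻¹.mulVec b) = dotProduct a' (N⁻¹.mulVec b') := by
  -- the extension by zero of `N⁻¹ b'`
  obtain ⟨u, hu⟩ : ∃ u : W → ℝ, ∀ p, u p = ∑ j, if e j = p then (N⁻¹.mulVec b') j else 0 :=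
    ⟨_, fun _ => rfl⟩
  have hext : ∀ f : W → ℝ, ∑ p, f p * u p = ∑ j, f (e j) * (N⁻¹.mulVec b') j := by
    intro f
    simp only [hu, Finset.mul_sum, mul_ite, mul_zero]
    rw [Finset.sum_comm]
    refine Finset.sum_congr rfl fun j _ => ?_
    rw [Finset.sum_ite_eq, if_pos (Finset.mem_univ _)]
  -- `M u = b`
  have hmul : M.mulVec u = b := by
    funext p
    change ∑ q, M p q * u q = b p
    rw [hext (fun q => M p q)]
    by_cases hp : p ∈ Set.range e
    · obtain ⟨i, rfl⟩ := hp
      simp only [hsub, hb]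
      have h1 : (N * N⁻¹).mulVec b' = b' := by
        rw [Matrix.mul_nonsing_inv _ hN, Matrix.one_mulVec]
      rw [← Matrix.mulVec_mulVec] at h1
      exact congrFun h1 i
    · rw [hb0 p hp]
      exact Finset.sum_eq_zero fun j _ => by rw [hoff p hp j, zero_mul]
  -- hence `M⁻¹ b = u`
  have hinv : M⁻¹.mulVec b = u := by
    rw [← hmul, Matrix.mulVec_mulVec, Matrix.nonsing_inv_mul _ hM, Matrix.one_mulVec]
  rw [hinv, dotProduct, hext a, dotProduct]
  simp only [ha]

/-! ## Transport of the `Law₂` functional -/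

/-- **Transport of the `Law₂` left-hand side** along an injection of the sites: for the
pushed-forward system `(K, e(C'))` and the sets `e(A')`, `e(B')`,
`v_{e(A')}ᵀ Σ⁻¹ v_{e(B')} = v'_{A'}ᵀ Σ'⁻¹ v'_{B'}` (primes: the system `(K, C')`). [folklore] -/
theorem l6f_law2_transport {V W ι : Type*} [Fintype V] [DecidableEq V] [Fintype W]
    [DecidableEq W] [Fintype ι] (e : V ↪ W) (K : ι → ℝ) (C' : ι → Finset V) (A' B' : Finset V)
    (hM : IsUnit (Matrix.of fun p q : W => gksExpect Finset.univ K (fun i => (C' i).map e)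
      (fun ω => spinAt p ω * spinAt q ω)).det)
    (hN : IsUnit (Matrix.of fun p q : V => gksExpect Finset.univ K C'
      (fun ω => spinAt p ω * spinAt q ω)).det) :
    dotProduct (fun w => gksExpect Finset.univ K (fun i => (C' i).map e)
        (fun ω => spinProduct (A'.map e) ω * spinAt w ω))
      (((Matrix.of fun p q : W => gksExpect Finset.univ K (fun i => (C' i).map e)
          (fun ω => spinAt p ω * spinAt q ω))⁻¹).mulVec
        (fun w => gksExpect Finset.univ K (fun i => (C' i).map e)
          (fun ω => spinProduct (B'.map e) ω * spinAt w ω)))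
    = dotProduct (fun w => gksExpect Finset.univ K C' (fun ω => spinProduct A' ω * spinAt w ω))
      (((Matrix.of fun p q : V => gksExpect Finset.univ K C'
          (fun ω => spinAt p ω * spinAt q ω))⁻¹).mulVec
        (fun w => gksExpect Finset.univ K C' (fun ω => spinProduct B' ω * spinAt w ω))) := by
  refine l6f_dot_inv e _ _ hM hN _ _ _ _ (fun i j => ?_) (fun p hp j => ?_)
    (fun j => ?_) (fun j => ?_) (fun p hp => ?_)
  · simp only [Matrix.of_apply]
    rw [← l6f_gksExpect_map Finset.univ e K C']
    simp only [l6f_spinAt_comp]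
  · simp only [Matrix.of_apply]
    exact l6f_pair_zero e K C' hp j
  · rw [← l6f_gksExpect_map Finset.univ e K C']
    simp only [l6f_spinAt_comp, l6f_spinProduct_comp]
  · rw [← l6f_gksExpect_map Finset.univ e K C']
    simp only [l6f_spinAt_comp, l6f_spinProduct_comp]
  · exact l6f_vec_zero e K C' B' hp

/-- **Transport of the `Law₂` right-hand side**: `⟨σ_{e(A')}σ_{e(B')}⟩ = ⟨σ_{A'}σ_{B'}⟩'`. [folklore] -/
theorem l6f_AB_transport {V W ι : Type*} [Fintype V] [DecidableEq V] [Fintype W]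
    [DecidableEq W] [Fintype ι] (e : V ↪ W) (K : ι → ℝ) (C' : ι → Finset V) (A' B' : Finset V) :
    gksExpect Finset.univ K (fun i => (C' i).map e)
        (fun ω => spinProduct (A'.map e) ω * spinProduct (B'.map e) ω)
      = gksExpect Finset.univ K C' (fun ω => spinProduct A' ω * spinProduct B' ω) := by
  rw [← l6f_gksExpect_map Finset.univ e K C']
  simp only [l6f_spinProduct_comp]

/-- A subset of `W` contained in the range of `e` is a pushed-forward subset. [folklore] -/
theorem l6f_exists_map {V W : Type*} [DecidableEq W] (e : V ↪ W) (t : Finset W)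
    (ht : ∀ p ∈ t, p ∈ Set.range e) : ∃ t' : Finset V, t'.map e = t := by
  classical
  refine ⟨t.preimage e e.injective.injOn, ?_⟩
  rw [Finset.map_eq_image, Finset.image_preimage]
  exact Finset.filter_true_of_mem ht

/-! ## The stub -/

/-- **`Law₂` on six sites with two free sites** (registered stub `helper_law2_six_free` of the
crux, line `Sketch`): if `x ≠ y` lie in no bond of a zero-field pair ferromagnet on `Fin 6` and
the 3-sets `A, B` avoid `x, y`, then `v_Aᵀ Σ⁻¹ v_B ≤ ⟨σ_Aσ_B⟩`.  By transport along the
enumeration `e : Fin 4 ↪ Fin 6` of `univ ∖ {x, y}` (`l6f_law2_transport`, `l6f_AB_transport`)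
this is `helper_law2_four` for the restricted system. [folklore] -/
theorem helper_law2_six_free :
    ∀ (m : ℕ) (K : Fin m → ℝ) (C : Fin m → Finset (Fin 6)), (∀ i, 0 ≤ K i) → (∀ i, (C i).card = 2) →
      ∀ x y : Fin 6, x ≠ y → (∀ i, x ∉ C i) → (∀ i, y ∉ C i) →
        ∀ (A B : Finset (Fin 6)), A.card = 3 → B.card = 3 → x ∉ A → y ∉ A → x ∉ B → y ∉ B →
          dotProduct (fun w => gksExpect Finset.univ K C (fun ω => spinProduct A ω * spinAt w ω))
            (((Matrix.of fun p q : Fin 6 =>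
                gksExpect Finset.univ K C (fun ω => spinAt p ω * spinAt q ω))⁻¹).mulVec
              (fun w => gksExpect Finset.univ K C (fun ω => spinProduct B ω * spinAt w ω)))
          ≤ gksExpect Finset.univ K C (fun ω => spinProduct A ω * spinProduct B ω) := by
  intro m K C hK hC x y hxy hx hy A B hA hB hxA hyA hxB hyB
  classical
  -- the four sites other than `x, y`, enumerated increasingly by `e : Fin 4 ↪ Fin 6`
  set S : Finset (Fin 6) := (Finset.univ.erase x).erase y with hS
  have hyS : y ∈ Finset.univ.erase x := Finset.mem_erase.2 ⟨hxy.symm, Finset.mem_univ _⟩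
  have hScard : S.card = 4 := by
    rw [hS, Finset.card_erase_of_mem hyS, Finset.card_erase_of_mem (Finset.mem_univ _),
      Finset.card_univ, Fintype.card_fin]
  have hmemS : ∀ p, p ∈ S ↔ p ≠ x ∧ p ≠ y := fun p => by
    simp only [hS, Finset.mem_erase, Finset.mem_univ, and_true]
    tauto
  obtain ⟨e, hrange⟩ : ∃ e : Fin 4 ↪ Fin 6, ∀ p, p ∈ Set.range e ↔ p ≠ x ∧ p ≠ y := by
    refine ⟨(S.orderEmbOfFin hScard).toEmbedding, fun p => ?_⟩
    rw [← hmemS, RelEmbedding.coe_toEmbedding, Finset.range_orderEmbOfFin, Finset.mem_coe]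
  -- every bond and `A, B` are pushed forward from `Fin 4`
  have hlift : ∀ t : Finset (Fin 6), x ∉ t → y ∉ t → ∃ t' : Finset (Fin 4), t'.map e = t :=
    fun t hxt hyt => l6f_exists_map e t fun p hp =>
      (hrange p).2 ⟨fun h => hxt (h ▸ hp), fun h => hyt (h ▸ hp)⟩
  obtain ⟨A', rfl⟩ := hlift A hxA hyA
  obtain ⟨B', rfl⟩ := hlift B hxB hyB
  choose C' hC' using fun i => hlift (C i) (hx i) (hy i)
  obtain rfl : C = fun i => (C' i).map e := funext fun i => (hC' i).symm
  have hA' : A'.card = 3 := by simpa using hA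
  have hB' : B'.card = 3 := by simpa using hB
  have hC'' : ∀ i, (C' i).card = 2 := fun i => by simpa using hC i
  have hM := (Matrix.isUnit_iff_isUnit_det _).mp
    (schur_posDef 6 m K (fun i => (C' i).map e)).isUnit
  have hN := (Matrix.isUnit_iff_isUnit_det _).mp (schur_posDef 4 m K C').isUnit
  calc _ = _ := l6f_law2_transport e K C' A' B' hM hN
    _ ≤ _ := helper_law2_four m K C' hK hC'' A' B' hA' hB'
    _ = _ := (l6f_AB_transport e K C' A' B').symm

end Summit.CriticalPhenomena.Ising3DConformalLimit.Cruxes.InverseMFerromagnet.PartialCovarianceLadder
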